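import Mathlib
import Summits.CriticalPhenomena.Ising3DConformalLimit.Theorems.PerfectScreeningMixedSpectralRepresentation

/-!
# Complete monotonicity of the axial quadratic forms (stub `consForm_alternating`)

A dividend ("rung 0") of line `Sketch` (canonical-lift spine, seat c1) of the crux
`CriticalTwoPointGSM` (stmt-CriticalPhenomena-8365): for every finitely supported real `v` on the
transverse plane `ℤ²` (support `s`) and all `n k ∈ ℕ`,

`0 ≤ ∑_{i ≤ k} (-1)^i C(k,i) Q_v(n+i)`, where `Q_v(m) = ∑_{x,y ∈ s} v_x v_y G((m, x - y))`,
`G = criticalTwoPoint 3 = ⟨σ₀σ_·⟩⁺_{β_c(3)}`,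

i.e. every axial quadratic form of the critical two-point function of the nearest-neighbour Ising
model on `ℤ³` is a completely monotone sequence. It is used (as its hypothesis) by the neighbour
stub `mixedDifference_le`.

Proof: by the tree's `Theorems.mixedSpectralRepresentation_proof` (Aizenman–Duminil-Copin 2021,
Prop. 5.3, quadratic-form version) there is a finite measure `μ_v ≥ 0` carried by `[0,1]` with
`Q_v(m) = ∫ t^{|m|} dμ_v` for all `m ∈ ℤ`. Pulling the finite alternating sum inside the integral
and using the binomial theorem `∑_{i ≤ k} (-1)^i C(k,i) t^{n+i} = tⁿ (1 - t)^k` gives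
`∑_{i ≤ k} (-1)^i C(k,i) Q_v(n+i) = ∫ tⁿ (1-t)^k dμ_v ≥ 0`, the integrand being nonnegative on
`[0,1]`, hence `μ_v`-a.e. Pure Mathlib on top of the representation; nothing else is in this file.
-/

noncomputable section

open MeasureTheory Filter Topology
open Literature.Probability.LatticeModels
open scoped BigOperators

namespace Summit.CriticalPhenomena.Ising3DConformalLimit.Theorems

namespace CriticalTwoPointGSMJs.ConsFormAlternating

/-- The binomial identity `∑_{i ≤ k} (-1)^i C(k,i) t^{n+i} = tⁿ (1 - t)^k`. -/
lemma alternating_sum_eq (t : ℝ) (n k : ℕ) :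
    ∑ i ∈ Finset.range (k + 1), (-1 : ℝ) ^ i * (k.choose i : ℝ) * t ^ (n + i) =
      t ^ n * (1 - t) ^ k := by
  rw [sub_eq_neg_add, add_pow, Finset.mul_sum]
  refine Finset.sum_congr rfl fun i _ => ?_
  rw [one_pow, mul_one, neg_pow, pow_add]
  ring

/-- A measure carried by `[0,1]` sees `t ∈ [0,1]` almost everywhere. -/
lemma ae_mem_Icc {μ : Measure ℝ} (hμ : μ (Set.Icc (0:ℝ) 1)ᶜ = 0) :
    ∀ᵐ t ∂μ, t ∈ Set.Icc (0:ℝ) 1 :=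
  mem_ae_iff.mpr hμ

/-- The monomials `t ↦ t^m` are integrable against a finite measure carried by `[0,1]`
(they are a.e. bounded by `1`). -/
lemma integrable_pow {μ : Measure ℝ} [IsFiniteMeasure μ] (hμ : μ (Set.Icc (0:ℝ) 1)ᶜ = 0)
    (m : ℕ) : Integrable (fun t : ℝ => t ^ m) μ := by
  refine Integrable.mono' (integrable_const (1 : ℝ)) (continuous_id.pow m).aestronglyMeasurable ?_
  filter_upwards [ae_mem_Icc hμ] with t ht
  rw [Real.norm_eq_abs, abs_of_nonneg (pow_nonneg ht.1 m)]
  exact pow_le_one₀ ht.1 ht.2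

/-- Pulling the alternating sum inside the integral: for a finite measure `μ` carried by `[0,1]`,
`∑_{i ≤ k} (-1)^i C(k,i) ∫ t^{n+i} dμ = ∫ tⁿ (1-t)^k dμ`. -/
lemma alternating_moment_eq {μ : Measure ℝ} [IsFiniteMeasure μ] (hμ : μ (Set.Icc (0:ℝ) 1)ᶜ = 0)
    (n k : ℕ) :
    ∑ i ∈ Finset.range (k + 1), (-1 : ℝ) ^ i * (k.choose i : ℝ) * ∫ t, t ^ (n + i) ∂μ =
      ∫ t, t ^ n * (1 - t) ^ k ∂μ := by
  have hint : ∀ i ∈ Finset.range (k + 1),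
      Integrable (fun t : ℝ => (-1 : ℝ) ^ i * (k.choose i : ℝ) * t ^ (n + i)) μ :=
    fun i _ => (integrable_pow hμ (n + i)).const_mul _
  calc ∑ i ∈ Finset.range (k + 1), (-1 : ℝ) ^ i * (k.choose i : ℝ) * ∫ t, t ^ (n + i) ∂μ
      = ∑ i ∈ Finset.range (k + 1), ∫ t, (-1 : ℝ) ^ i * (k.choose i : ℝ) * t ^ (n + i) ∂μ :=
        Finset.sum_congr rfl fun i _ => (integral_const_mul _ _).symm
    _ = ∫ t, ∑ i ∈ Finset.range (k + 1), (-1 : ℝ) ^ i * (k.choose i : ℝ) * t ^ (n + i) ∂μ :=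
        (integral_finsetSum _ hint).symm
    _ = ∫ t, t ^ n * (1 - t) ^ k ∂μ :=
        integral_congr_ae (ae_of_all _ fun t => alternating_sum_eq t n k)

/-- For a finite measure `μ` carried by `[0,1]`, `0 ≤ ∫ tⁿ (1-t)^k dμ`. -/
lemma integral_pow_mul_one_sub_pow_nonneg {μ : Measure ℝ} (hμ : μ (Set.Icc (0:ℝ) 1)ᶜ = 0)
    (n k : ℕ) : 0 ≤ ∫ t, t ^ n * (1 - t) ^ k ∂μ :=
  integral_nonneg_of_ae ((ae_mem_Icc hμ).mono fun _ ht =>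
    mul_nonneg (pow_nonneg ht.1 n) (pow_nonneg (sub_nonneg.mpr ht.2) k))

end CriticalTwoPointGSMJs.ConsFormAlternating

open CriticalTwoPointGSMJs.ConsFormAlternating in
/-- **Complete monotonicity of the axial quadratic forms (stub `consForm_alternating`, rung 0).**
For every finitely supported real `v` on `ℤ²` (support `s`) and all `n k ∈ ℕ`,
`0 ≤ ∑_{i ≤ k} (-1)^i C(k,i) Q_v(n+i)` where `Q_v(m) = ∑_{x,y ∈ s} v_x v_y ⟨σ₀σ_{(m,x-y)}⟩⁺_{β_c}`:
by `Theorems.mixedSpectralRepresentation_proof`, `Q_v(m) = ∫ t^{|m|} dμ_v` for a finite measure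
`μ_v ≥ 0` on `[0,1]`, so the alternating sum equals `∫ tⁿ (1-t)^k dμ_v ≥ 0`. -/
theorem consForm_alternating : ∀ (s : Finset (Fin 2 → ℤ)) (v : (Fin 2 → ℤ) → ℝ) (n k : ℕ),
    0 ≤ ∑ i ∈ Finset.range (k + 1), (-1 : ℝ) ^ i * (k.choose i : ℝ) *
      ∑ x ∈ s, ∑ y ∈ s, v x * v y * criticalTwoPoint 3 (Fin.cons (((n + i : ℕ)) : ℤ) (x - y)) := by
  intro s v n k
  obtain ⟨μ, hfin, hμ, hrep⟩ := mixedSpectralRepresentation_proof s v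
  have hQ : ∀ i : ℕ, ∑ x ∈ s, ∑ y ∈ s,
      v x * v y * criticalTwoPoint 3 (Fin.cons (((n + i : ℕ)) : ℤ) (x - y)) = ∫ t, t ^ (n + i) ∂μ :=
    fun i => by rw [hrep ((n + i : ℕ) : ℤ), Int.natAbs_natCast]
  simp only [hQ]
  rw [alternating_moment_eq hμ n k]
  exact integral_pow_mul_one_sub_pow_nonneg hμ n k

end Summit.CriticalPhenomena.Ising3DConformalLimit.Theorems

end
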